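import Summits.Ventures.AbcShadow.SH27.CurveTables

/-!
# Venture AbcShadow — SH-27 CURVE SIDE, KERNEL TABLE at `(29, z² + 3)`: the realised trace set `R₂₉ = {−42, 22, 42, 54, 58}`

HONEST FRAMING. Computation file of the work-bound cell `abc-shadow` (typer seat `abc-shadow-typ-4`, row SH-27); no claim on
abc, on any summit, or on IUT; no Diophantine statement. EVALUATED BY THE KERNEL (`decide +kernel`, ≈ 70 s per curve: the
`29 + 1` projective classes × the `841` points of `𝔽_{29²}`) from the definitions of `SH27/CurveSide.lean`: for BOTH curves
`E ∈ {E^t, E^s}` and EVERY `(u, v) ∈ 𝔽₂₉² ∖ {(0,0)}`, `a_𝔮(E_β(u,v)) ∈ R₂₉ = {−42, 22, 42, 54, 58}`, `𝔮 = (29, z² + 3)`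
(`realised_29`; all classes via the proved twist rule `mem_of_realisedCheck`). Residues mod 17: `{3, 5, 7, 8, 9}` — none is
`6`, the value the surviving newform orbit `180.ψ.5` would force at its degree-1 primes above 17 (see `SH27/NewformSide.lean`).
This is the decisive datum of certificate 1f9122f05be32705 (block (K) q = 29 and C27-2, FULL 840-class enumeration there;
re-derived independently in crit-1-SH27-K3.md §2(b)), here re-computed by the kernel from the printed equations.
ADJACENT (generalized Fermat `(2, 34, 5)`), NOT abc.
-/

namespace Summit.Ventures.AbcShadow
namespace SH27

/-- Kernel: the projective-class check at `(29, z² + 3)` for `E^t` (30 classes × 841 points). [folklore] -/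
theorem realisedCheck_29_t : realisedCheck .t 29 3 0 R29 = true := by
  decide +kernel

/-- Kernel: the projective-class check at `(29, z² + 3)` for `E^s`. [folklore] -/
theorem realisedCheck_29_s : realisedCheck .s 29 3 0 R29 = true := by
  decide +kernel

/-- **Realised traces at `(29, z² + 3)`**: `a_𝔮(E_β(u,v)) ∈ R₂₉` for both curves and all `(u,v) ≢ (0,0) (mod 29)` — the
decisive datum of the row (none of these is `≡ 6 (mod 17)`). [cite: Chen2010, (2), (5), (10) pp.351–357 (the models; values COMPUTED here)] -/
theorem realised_29 (E : CurveTag) (u v : ZMod 29) (huv : (u, v) ≠ (0, 0)) : curveTrace E 29 [3, 0, 1] u v ∈ R29 := by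
  haveI : Fact (Nat.Prime 29) := ⟨by norm_num⟩
  show curveTrace2 E 29 3 0 u v ∈ R29
  cases E
  · exact mem_of_realisedCheck (by norm_num) realisedCheck_29_t u v huv
  · exact mem_of_realisedCheck (by norm_num) realisedCheck_29_s u v huv

/-- Faithfulness cross-check at `q = 29`: the CM control classes of spec 9d55c9c4a06f0a3d C-E4 / certificate C27-1
(`A_{E^t}(0,1) = 42 = (−4i)² − 2(−29)` from the CM orbit 180.ψ.3, `A_{E^s}(1,0) = 42`), and `A_{E^s}(0,1) = 22`,
`A_{E^t}(1,0) = 22`. [cite: Chen2010, p.365 L27–32 (the trivial solutions give the CM curves E₀, E₁)] -/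
theorem crosscheck_29 :
    curveTrace2 .t 29 3 0 0 1 = 42 ∧ curveTrace2 .s 29 3 0 1 0 = 42 ∧ curveTrace2 .s 29 3 0 0 1 = 22 ∧
      curveTrace2 .t 29 3 0 1 0 = 22 := by
  decide +kernel

end SH27
end Summit.Ventures.AbcShadow
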